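import Summits.BirchSwinnertonDyer.Statement
import Literature.NumberTheory.EllipticCurves.Rank1Residual.Typed.X5
import Literature.NumberTheory.EllipticCurves.Rank1Residual.Predicates
import Summits.BirchSwinnertonDyer.BirchSwinnertonDyer.Theorems.Rank1ResidualX5TwoDefs
import Literature.NumberTheory.EllipticCurves.Rank1Residual.Typed.Basic
import Literature.NumberTheory.EllipticCurves.LeadingTerm
import Literature.Uncategorized.OrdPublishedInputsAtTwo
import Summits.BirchSwinnertonDyer.BirchSwinnertonDyer.Theorems.ByReductionTypeAtTwoOrdHalvesDefs
import Summits.BirchSwinnertonDyer.BirchSwinnertonDyer.Theorems.ByReductionTypeAtTwoLambdaConstPinchEnd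
import Literature.NumberTheory.EllipticCurves.KatoDivisibilityAllPrimes
import Literature.NumberTheory.EllipticCurves.Greenberg1999.RankZeroEulerCharacteristicAnyPrime
import Literature.NumberTheory.EllipticCurves.ModularCurve
import Summits.BirchSwinnertonDyer.BirchSwinnertonDyer.Theorems.ByReductionTypeAtTwoOrdMissingLowerBoundDefs
import Literature.NumberTheory.EllipticCurves.BSDQuadraticDescent
import Literature.NumberTheory.EllipticCurves.AnalyticRank
import Literature.NumberTheory.EllipticCurves.Isogeny
import Summits.BirchSwinnertonDyer.Rank1Residual.X5.TwoAdicTargetsMultTam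
import Summits.BirchSwinnertonDyer.Rank1Residual.X2.IsogenyQuotientLine
import Literature.NumberTheory.EllipticCurves.SkinnerUrban2014.PAdicUnitPeriodRatioAnyPrimeProofs
import Summits.BirchSwinnertonDyer.Rank1Residual.X12.InertCoreEveryCurve
import Literature.NumberTheory.EllipticCurves.ComplexMultiplicationNotSemistable
import Literature.NumberTheory.EllipticCurves.Zhai2021.TwoAdicLowerBoundTwists
import Literature.NumberTheory.EllipticCurves.ModularParametrizationBCDTProofs
import HarnessLib

/-!
# Route `ByReductionTypeAtTwo`, crux `MultUpperHalfAtTwo` (item stmt-BirchSwinnertonDyer-19922): the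
# Euler-system (upper) half `ord₂ #Ш ≤ ord₂ #Ш_an` at a multiplicative `2` is an ISOGENY-CLASS statement,
# and its two open class-wide inputs are needed at ONE member only

HONEST FRAMING (cell `bsd-2adic`, run/shared/lean/pub/bsd-2adic/, seat `bsd-2adic-mult-2`, D-0074 row
(A)): research route; nothing is booked; BSD is not proved by any of this. PARTITION: X5@2 mult (K4ᵐ,
RESIDUAL-MAP B1·O1; 1 976 book230 classes) × p = 2 — types-the-object-of (the road of item 19922 as a
per-class theorem with a sharply smaller open input); closes none.

The landed road to the upper half (`O1.missingUpperBoundAt_two_mult_of_mu_eq_zero`,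
`X5/TwoAdicTargetsMultTam.lean`; ∀-closed in p409679 `multiplicativeRankZeroAtTwo_of_muRoad`) consumes PER
CURVE `W`: PRINT {Greenberg's displays A235/A236, modularity, GZK}, the refereed memo binders {Kato `⊗ℚ`
at a multiplicative `2` (`O1.KatoMultiplicativeDivisibilityRat`, RC-2), Greenberg–Stevens at a split `2`
(`greenberg_stevens`, RC-4)} and TWO OPEN class-wide inputs, `μ(X(E/ℚ_∞)) = 0` (`hμ`) and the
`2`-integrality of the period ratio `ϖ = Ω⁺_f/Ω_W` (`hper₀`). Read member by member both FAIL somewhere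
in most classes with a rational `2`-isogeny (`μ ≥ 1` on Greenberg's Prop. 5.13 locus; `ord₂ ϖ < 0` above
the `X₀(N)`-optimal curve by an even real-lattice index). This file proves the class-level form:
§1 the upper half is a `ℚ`-isogeny invariant (Cassels 1965 + `L(W,s) = L(W',s)`; tree theorem
`X12.missingUpperBoundAt_of_isIsogenous`, reused) and every class has an `X₀(N)`-OPTIMAL member from
modularity (`X12.exists_isIsogenous_optimal`, reused); §2 the period input is PRINT at two kinds of members
— `E[2]` irreducible (Greenberg–Vatsal Rem. 3.4 at `p = 2` through Česnavičius 2018 Thm. 1.2, tree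
theorem `realPeriodRat_eq_unit_mul_plusPeriod_two_of_cesnavicius`) and the `X₀(N)`-optimal member
(`Ω(W₀) = |c₀|·Ω⁺_f` exactly, `realPeriodRat_eq_abs_mul_plusPeriod_of_latticeEq`; `c₀` odd at `2 ∥ N`,
Česnavičius 2018 Thm. 1.2 = named fact `cesnavicius_not_two_dvd_maninConstant_of_two_dvd_level`); §3 the
per-member road with Greenberg–Stevens GUARDED by `split`; §4 **`missingUpperBoundAt_two_mult_of_roadMember`**:
for `W` of analytic rank `0` multiplicative at `2`, ONE globally minimal `W₁ ~_ℚ W` with (A) `μ = 0` OR a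
Prop-5.14 datum (then `μ = 0` is PRINT, Greenberg 1999 Prop. 5.14) and (B) `E₁[2]` irreducible OR
`X₀(N)`-optimal (`Zhai2021.IsOptimalDatum` at level `N_{W₁}`) OR `0 ≤ ord₂ ϖ` directly, gives
`MissingUpperBoundAt W 2`; corollary `…_of_optimal514`: every class whose `X₀(N)`-optimal curve lies on
the Prop-5.14 locus has the upper half at EVERY member from PRINT + MEMO alone (no `μ`-certificate, no
period datum, no `λ`); on the `E[2]`-irreducible classes (1 680 of 1 976) the only open input is `μ = 0`
at one member (`hA := Or.inl hμ`, `hB := Or.inl hirr`; Greenberg's Conj. 1.11 at `2`); §5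
**`multUpperHalfAtTwo_of_optimalMuZero_of_offRoad`** — the FULLY-QUALIFIED route decl from the same binders
and ONE residual hypothesis `hoff`: the upper half at the `X₀(N)`-optimal curves of the class whose
cyclotomic `μ` is not known to vanish (no `μ = 0`, no 5.14 datum). So item 19922 SPLITS as
«`μ(X(E₀/ℚ_∞)) = 0` at the optimal curve `E₀` of the class ⟹ upper half for the whole class (PROVED
modulo the two refereed memo facts)» ⊔ «optimal curves with `μ ≥ 1`: the `μ`-part of Kato's divisibility
at `2` is genuinely needed (Kato 17.4 (3) prints `p ≠ 2`), OPEN» — a partition certificate, NOT a proof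
of the item; the residual is expected non-empty (cf. Greenberg's conductor-`15` table at `2`).

References: [Cassels1965ArithmeticVIII]; [MilneADT2006] Thm. I.7.3; [Miller2011LMS] Def. 1.1, §1;
[Cesnavicius2018] Thm. 1.2; [GreenbergVatsal2000] §3 Rem. 3.4; [EdixhovenManin1991] Prop. 2;
[GreenbergLNM1716] Prop. 5.13, Prop. 5.14, §4 pp. 112–113; [Kato2004Asterisque] Thm. 17.4/17.13;
[Kobayashi2006DocMath] Cor. 4.2; [MazurTateTeitelbaum1986Invent] §I.10–I.12.
-/

set_option autoImplicit false
set_option linter.dupNamespace false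

noncomputable section

open scoped Classical MatrixGroups ModularForm

open CongruenceSubgroup WeierstrassCurve Literature.NumberTheory.EllipticCurves
  Literature.NumberTheory.EllipticCurves.ModularForms
  Literature.NumberTheory.EllipticCurves.Greenberg1999
  Literature.NumberTheory.EllipticCurves.Rank1Residual
  Literature.NumberTheory.EllipticCurves.Rank1Residual.Typed
  Summit.BirchSwinnertonDyer.Rank1Residual.X5

namespace Summit.BirchSwinnertonDyer.BirchSwinnertonDyer.Theorems

/-! ## §1 Transport and modularity bookkeeping

The upper half is a `ℚ`-isogeny invariant (Cassels 1965 + `L(W,s) = L(W',s)`): this is the tree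
theorem `Summit.BirchSwinnertonDyer.Rank1Residual.X12.missingUpperBoundAt_of_isIsogenous` (cell
`b2b-bsdres`, class X12), reused here verbatim; every class has an `X₀(N)`-optimal member from
modularity alone: `Summit.BirchSwinnertonDyer.Rank1Residual.X12.exists_isIsogenous_optimal` (its input
`exists_isNewformOf` follows from the doors' binder `nonempty_modularParametrizationData`,
`exists_isNewformOf_of_nonempty_modularParametrizationData`, BCDT (6) ⇒ (2)). -/

/-! ## §2 The period input `0 ≤ ord₂ ϖ` is PRINT at two kinds of members -/

/-- For an integer `z` not divisible by the prime `p`, `‖z‖_p = 1`. [folklore] -/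
private theorem padicNorm_intCast_eq_one_of_not_dvd {p : ℕ} [Fact p.Prime] {z : ℤ}
    (h : ¬ (p : ℤ) ∣ z) : ‖(z : ℚ_[p])‖ = 1 :=
  le_antisymm (Padic.norm_int_le_one z)
    (not_lt.mp fun hlt ↦ h (Padic.norm_intCast_lt_one_iff.mp hlt))

/-- **Period control on the `E[2]`-irreducible locus (PRINT).** For a globally minimal elliptic `W/ℚ`
multiplicative at `2` with `ρ̄_{E,2}` irreducible and a newform `f` of `W` (any level), every `ϖ ∈ ℚ`
with `ϖ · Ω(W) = Ω⁺_f` has `ord₂ ϖ = 0`: Greenberg–Vatsal's Remark 3.4 at `p = 2` (no `2`-isogeny in the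
class, so Néron periods of the class differ by odd rationals from `|c₀|·Ω⁺_f`) with the Manin constant
of the optimal curve odd at `2 ∥ N` (Česnavičius 2018 Thm. 1.2, named fact `hC`); tree theorems
`SkinnerUrban2014.realPeriodRat_eq_unit_mul_plusPeriod_two_of_cesnavicius`,
`Rank1Residual.padicValRat_periodRatio_eq_zero_of_eq_unit_mul`. [cite: GreenbergVatsal2000, §3, Remark 3.4]
[cite: Cesnavicius2018, Thm. 1.2] -/
theorem padicValRat_periodRatio_eq_zero_of_irr_two
    (hC : cesnavicius_not_two_dvd_maninConstant_of_two_dvd_level) (W : WeierstrassCurve ℚ)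
    [W.IsElliptic] [W.IsGloballyMinimal] (hmult : Mult W 2) (hirr : Irr W 2)
    {N : ℕ} [NeZero N] (f : CuspForm (Gamma0 N) 2) (hf : IsNewformOf W f) (ϖ : ℚ)
    (hϖ : (ϖ : ℝ) * W.realPeriodRat = plusPeriod f) : padicValRat 2 ϖ = 0 := by
  obtain ⟨u, hu, hΩ⟩ :=
    SkinnerUrban2014.realPeriodRat_eq_unit_mul_plusPeriod_two_of_cesnavicius hC W hmult hirr f hf
  exact Rank1Residual.padicValRat_periodRatio_eq_zero_of_eq_unit_mul W 2 f hu hΩ ϖ hϖ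

/-- **Period control at the `X₀(N)`-OPTIMAL member (PRINT).** For a globally minimal elliptic `W₀/ℚ`
multiplicative at `2` carrying a LATTICE-OPTIMAL parametrisation datum `D` (`Λ_{W₀} = c Λ_f`, i.e.
`Zhai2021.IsOptimalDatum W₀ D` together with the structure field `c Λ_f ⊆ Λ_{W₀}`: `W₀` is the strong Weil
curve of its class and `c` its Manin constant, Edixhoven 1991 Prop. 2), a newform `f` of `W₀` at the
level of `D`, and `ϖ ∈ ℚ` with `ϖ · Ω(W₀) = Ω⁺_f`: `ord₂ ϖ = 0`. Indeed `Ω(W₀) = |c| · Ω⁺_f` exactly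
(`ModularParametrizationData.realPeriodRat_eq_abs_mul_plusPeriod_of_latticeEq`), `f = D.f` by multiplicity
one, and `c` is odd because `2 ∥ N` at a multiplicative `2` (Česnavičius 2018 Thm. 1.2, named fact `hC`;
`2 ∣ N`, `4 ∤ N` from `not_sq_dvd_level_of_hasMultiplicativeReductionAtPrime`).
[cite: Cesnavicius2018, Thm. 1.2] [cite: EdixhovenManin1991, Prop. 2 and §1] -/
theorem padicValRat_periodRatio_eq_zero_of_isOptimalDatum
    (hC : cesnavicius_not_two_dvd_maninConstant_of_two_dvd_level) (W : WeierstrassCurve ℚ)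
    [W.IsElliptic] [W.IsGloballyMinimal] (hmult : Mult W 2)
    {N : ℕ} [NeZero N] (D : ModularParametrizationData W N) (hopt : Zhai2021.IsOptimalDatum W D)
    (f : CuspForm (Gamma0 N) 2) (hf : IsNewformOf W f) (ϖ : ℚ)
    (hϖ : (ϖ : ℝ) * W.realPeriodRat = plusPeriod f) : padicValRat 2 ϖ = 0 := by
  have hDf : D.f = f := D.isNewformOf.unique hf
  have hngood : ¬ W.HasGoodReductionAtPrime 2 :=
    WeierstrassCurve.HasMultiplicativeReduction.not_hasGoodReduction (R := ℤ_[2]) hmult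
  have h2N : 2 ∣ N :=
    (hf.dvd_level_iff_dvd_conductorNorm Fact.out).mpr
      ((W.dvd_conductorNorm_iff_not_hasGoodReductionAtPrime 2).mpr hngood)
  have h4N : ¬ 2 ^ 2 ∣ N :=
    SkinnerUrban2014.not_sq_dvd_level_of_hasMultiplicativeReductionAtPrime hmult hf
  have hc : ¬ (2 : ℤ) ∣ D.c := hC W D hopt h2N h4N
  have hcabs : ¬ ((2 : ℕ) : ℤ) ∣ |D.c| := fun h ↦ hc ((dvd_abs _ _).mp (by exact_mod_cast h))
  have hu : ‖(((|D.c| : ℤ) : ℚ) : ℚ_[2])‖ = 1 := by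
    rw [Rat.cast_intCast]
    exact padicNorm_intCast_eq_one_of_not_dvd hcabs
  have hΩ : W.realPeriodRat = |(D.c : ℝ)| * plusPeriod D.f :=
    D.realPeriodRat_eq_abs_mul_plusPeriod_of_latticeEq hopt
  have hΩ' : W.realPeriodRat = (((|D.c| : ℤ) : ℚ) : ℝ) * plusPeriod f := by
    rw [hΩ, hDf, Rat.cast_intCast, Int.cast_abs]
  exact Rank1Residual.padicValRat_periodRatio_eq_zero_of_eq_unit_mul W 2 f hu hΩ' ϖ hϖ

/-! ## §3 The per-member road, both signs, Greenberg–Stevens guarded by `split` -/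

/-- **`MissingUpperBoundAt W 2` at a multiplicative `2`, analytic rank `0`, from `μ = 0` and
`0 ≤ ord₂ ϖ` at THIS member (both signs).** Inputs: Kato `⊗ℚ` at a multiplicative `2` (`hKato`, the
prime-uniform memo binder, projected onto K11a/K11b-Rat), Greenberg's displays A235 `h41ns` / A236
`h41sp`, modularity, GZK (PRINT), Greenberg–Stevens at a SPLIT `2` only (`hGS`, guarded; converted to the
`κ₁`-certificate by `O1.kappaOne_binder_of_greenbergStevens`), `hμ`, `hper₀`. Split:
`O1.missingUpperBoundAt_two_split_of_mu_eq_zero_auto`; non-split: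
`O1.missingUpperBoundAt_two_nonsplit_of_mu_eq_zero_auto`. Composition; nothing asserted.
[cite: GreenbergLNM1716, §4 pp. 112–113] [cite: Kato2004Asterisque, Thm. 17.4 and 17.13]
[cite: Kobayashi2006DocMath, Cor. 4.2] [cite: Miller2011LMS, Def. 1.1] -/
theorem missingUpperBoundAt_two_mult_of_mu_eq_zero_of_period (W : WeierstrassCurve ℚ)
    [W.IsElliptic] [W.IsGloballyMinimal] (hKato : O1.KatoMultiplicativeDivisibilityRat W 2)
    (h41ns : thm41Analogue_charValue_rankZero_numberField_anyPrime)
    (h41sp : thm41Analogue_charValue_rankZero_split_baseChange_anyPrime)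
    (hmod : nonempty_modularParametrizationData)
    (hGZK : rank_eq_analyticRank_of_analyticRank_le_one)
    (hGS : W.HasSplitMultiplicativeReductionAtPrime 2 → greenberg_stevens (W := W) (p := 2))
    (hμ : ∀ (κ : ZpExtension ℚ 2) (γ : Field.absoluteGaloisGroup ℚ), κ.IsCyclotomic →
      κ.IsTopGenerator γ → IsCyclotomicVariable 2 γ → ∀ D : W.SelmerDualData κ γ, D.mu = 0)
    (hper₀ : ∀ [NeZero (W.conductorNorm ℤ)] (f : CuspForm (Gamma0 (W.conductorNorm ℤ)) 2),
      IsNewformOf W f → ∀ ϖ : ℚ, (ϖ : ℝ) * W.realPeriodRat = plusPeriod f → 0 ≤ padicValRat 2 ϖ)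
    (hr : W.analyticRank = 0) (hmult : Mult W 2) : MissingUpperBoundAt W 2 := by
  by_cases hsp : W.HasSplitMultiplicativeReductionAtPrime 2
  · exact O1.missingUpperBoundAt_two_split_of_mu_eq_zero_auto W
      (O1.twoAdicEulerCharRankZeroSplitMult_zero_of_greenberg W h41sp) hmod hGZK
      (fun f L => O1.katoDivisibilityAtTwoSplitMultRat_of_multRat W hKato f L) hμ
      (O1.kappaOne_binder_of_greenbergStevens W (hGS hsp) hr) hper₀ hr hmult hsp
  · exact O1.missingUpperBoundAt_two_nonsplit_of_mu_eq_zero_auto W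
      (O1.twoAdicEulerCharRankZeroNonsplitMult_zero_of_greenberg W h41ns) hmod hGZK
      (fun f L => O1.katoDivisibilityAtTwoNonsplitMultRat_of_multRat W hKato f L) hμ hper₀ hr hmult
      hsp

/-! ## §4 The class theorem: the two open inputs at ONE member -/

/-- **The upper half at a multiplicative `2` from ONE road member of the isogeny class.** For a globally
minimal elliptic `W/ℚ` of analytic rank `0` multiplicative at `2` and a globally minimal `W₁ ~_ℚ W` with
(A) `μ(X(W₁/ℚ_∞)) = 0` for every cyclotomic dual datum, OR a Prop-5.14 datum on `W₁` (a rational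
`2`-torsion point `(x, y)`, ramified-at-`2` XOR odd — then `μ = 0` is Greenberg 1999 Prop. 5.14 at a
multiplicative `2`, PRINT `h514`), and
(B) `E₁[2]` irreducible, OR a lattice-optimal parametrisation datum of `W₁` at level `N_{W₁}` (`W₁` is the
`X₀(N)`-optimal curve), OR `0 ≤ ord₂ ϖ` for the period ratios of `W₁` directly —
`MissingUpperBoundAt W 2` holds. Class data move to `W₁` (multiplicative reduction, analytic rank, no CM:
`X2.IsogenyQuotientLine.hasMultiplicativeReductionAtPrime_of_isIsogenous`, `analyticRank_eq_of_isIsogenous'`,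
`not_mult_of_hasCM`); §3 gives the upper half at `W₁`; §1 (Cassels) carries it to `W`. Binders: PRINT
{`h41ns`, `h41sp`, `hmod`, `hGZK`, `hCassels`, `h514`, `hC`} + MEMO {`hKato` (RC-2), `hGS` (RC-4)}.
[cite: GreenbergLNM1716, Prop. 5.14 (p. 121) and §4 pp. 112–113] [cite: Cesnavicius2018, Thm. 1.2]
[cite: Cassels1965ArithmeticVIII] [cite: Miller2011LMS, §1 and Def. 1.1] -/
theorem missingUpperBoundAt_two_mult_of_roadMember
    (hKato : ∀ (W : WeierstrassCurve ℚ) [W.IsElliptic] [W.IsGloballyMinimal],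
      ¬ W.HasCM → Mult W 2 → O1.KatoMultiplicativeDivisibilityRat W 2)
    (h41ns : thm41Analogue_charValue_rankZero_numberField_anyPrime)
    (h41sp : thm41Analogue_charValue_rankZero_split_baseChange_anyPrime)
    (hmod : nonempty_modularParametrizationData)
    (hGZK : rank_eq_analyticRank_of_analyticRank_le_one)
    (hCassels : bsdRHS_eq_of_isIsogenous)
    (h514 : prop514_isTorsion_mu_eq_zero_two)
    (hC : cesnavicius_not_two_dvd_maninConstant_of_two_dvd_level)
    (hGS : ∀ (W : WeierstrassCurve ℚ) [W.IsElliptic] [W.IsGloballyMinimal],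
      W.HasSplitMultiplicativeReductionAtPrime 2 → greenberg_stevens (W := W) (p := 2))
    (W : WeierstrassCurve ℚ) [W.IsElliptic] [W.IsGloballyMinimal]
    (hr : W.analyticRank = 0) (hmult : Mult W 2)
    (W₁ : WeierstrassCurve ℚ) [W₁.IsElliptic] [W₁.IsGloballyMinimal] (hiso : IsIsogenous W W₁)
    (hA : (∀ (κ : ZpExtension ℚ 2) (γ : Field.absoluteGaloisGroup ℚ), κ.IsCyclotomic →
        κ.IsTopGenerator γ → IsCyclotomicVariable 2 γ → ∀ D : W₁.SelmerDualData κ γ, D.mu = 0) ∨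
      (∃ x y : ℚ, W₁.toAffine.Equation x y ∧ 2 * y + W₁.a₁ * x + W₁.a₃ = 0 ∧
        ((TwoTorsionRamifiedAtTwo x ∧ ¬ TwoTorsionOdd W₁ x) ∨
          (TwoTorsionOdd W₁ x ∧ ¬ TwoTorsionRamifiedAtTwo x))))
    (hB : Irr W₁ 2 ∨
      (∀ [NeZero (W₁.conductorNorm ℤ)],
        ∃ D : ModularParametrizationData W₁ (W₁.conductorNorm ℤ), Zhai2021.IsOptimalDatum W₁ D) ∨
      (∀ [NeZero (W₁.conductorNorm ℤ)] (f : CuspForm (Gamma0 (W₁.conductorNorm ℤ)) 2),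
        IsNewformOf W₁ f → ∀ ϖ : ℚ, (ϖ : ℝ) * W₁.realPeriodRat = plusPeriod f →
          0 ≤ padicValRat 2 ϖ)) :
    MissingUpperBoundAt W 2 := by
  -- the class data at `W₁`
  have hmult₁ : Mult W₁ 2 :=
    Summit.BirchSwinnertonDyer.Rank1Residual.X2.IsogenyQuotientLine.hasMultiplicativeReductionAtPrime_of_isIsogenous
      hiso hmult
  have hr₁ : W₁.analyticRank = 0 := (analyticRank_eq_of_isIsogenous' hiso).symm.trans hr
  have hcm₁ : ¬ W₁.HasCM := fun h ↦ Rank1Residual.not_mult_of_hasCM W₁ h 2 hmult₁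
  -- (A) `μ = 0` at `W₁`
  have hμ₁ : ∀ (κ : ZpExtension ℚ 2) (γ : Field.absoluteGaloisGroup ℚ), κ.IsCyclotomic →
      κ.IsTopGenerator γ → IsCyclotomicVariable 2 γ → ∀ D : W₁.SelmerDualData κ γ, D.mu = 0 := by
    rcases hA with hμ | ⟨x, y, hP, h2, hΦ⟩
    · exact hμ
    · exact fun _ _ hκ hγ _ D ↦ (h514.of_mult W₁ hmult₁ hP h2 hΦ hκ hγ D).2
  -- (B) `0 ≤ ord₂ ϖ` at `W₁`
  have hper₁ : ∀ [NeZero (W₁.conductorNorm ℤ)] (f : CuspForm (Gamma0 (W₁.conductorNorm ℤ)) 2),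
      IsNewformOf W₁ f → ∀ ϖ : ℚ, (ϖ : ℝ) * W₁.realPeriodRat = plusPeriod f →
        0 ≤ padicValRat 2 ϖ := by
    rcases hB with hirr | hopt | hper
    · intro _ f hf ϖ hϖ
      exact (padicValRat_periodRatio_eq_zero_of_irr_two hC W₁ hmult₁ hirr f hf ϖ hϖ).ge
    · intro _ f hf ϖ hϖ
      obtain ⟨D, hD⟩ := hopt
      exact (padicValRat_periodRatio_eq_zero_of_isOptimalDatum hC W₁ hmult₁ D hD f hf ϖ hϖ).ge
    · exact hper
  -- the road at `W₁`, then Cassels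
  have hU₁ : MissingUpperBoundAt W₁ 2 :=
    missingUpperBoundAt_two_mult_of_mu_eq_zero_of_period W₁ (hKato W₁ hcm₁ hmult₁) h41ns h41sp hmod
      hGZK (hGS W₁) hμ₁ hper₁ hr₁ hmult₁
  haveI : NeZero (W₁.conductorNorm ℤ) := ⟨(W₁.conductorNorm_pos_holds).ne'⟩
  obtain ⟨Dm⟩ := hmod W₁
  have hlead₁ : W₁.leadingLCoeff ≠ 0 :=
    W₁.leadingLCoeff_ne_zero_holds Dm.isNewformOf.hasEntireLFunction
  have hfin₁ : Finite W₁.sha := (hGZK W₁ (by rw [hr₁]; exact zero_le_one)).2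
  exact Summit.BirchSwinnertonDyer.Rank1Residual.X12.missingUpperBoundAt_of_isIsogenous hCassels hiso
    hfin₁ hlead₁ hU₁

/-- **Corollary (optimal curve on the Prop-5.14 locus): the upper half at EVERY member from PRINT +
MEMO alone.** For `W` of analytic rank `0` multiplicative at `2`: if the `X₀(N)`-optimal member `W₀ ~_ℚ W`
(globally minimal, with a lattice-optimal parametrisation datum at level `N_{W₀}`) carries a rational
`2`-torsion point `(x, y)` that is ramified-at-`2` XOR odd (Greenberg's Prop-5.14 configuration), then
`MissingUpperBoundAt W 2` — with NO `μ`-certificate (Prop. 5.14 at a multiplicative `2`, PRINT), NO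
period datum (Česnavičius 2018 Thm. 1.2, PRINT) and NO `λ`. This is the class-level form of the cell's
«door-ready» GV-mult / LAW classes on the UPPER half. [cite: GreenbergLNM1716, Prop. 5.14 (p. 121)]
[cite: Cesnavicius2018, Thm. 1.2] [cite: Cassels1965ArithmeticVIII] -/
theorem missingUpperBoundAt_two_mult_of_optimal514
    (hKato : ∀ (W : WeierstrassCurve ℚ) [W.IsElliptic] [W.IsGloballyMinimal],
      ¬ W.HasCM → Mult W 2 → O1.KatoMultiplicativeDivisibilityRat W 2)
    (h41ns : thm41Analogue_charValue_rankZero_numberField_anyPrime)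
    (h41sp : thm41Analogue_charValue_rankZero_split_baseChange_anyPrime)
    (hmod : nonempty_modularParametrizationData)
    (hGZK : rank_eq_analyticRank_of_analyticRank_le_one)
    (hCassels : bsdRHS_eq_of_isIsogenous)
    (h514 : prop514_isTorsion_mu_eq_zero_two)
    (hC : cesnavicius_not_two_dvd_maninConstant_of_two_dvd_level)
    (hGS : ∀ (W : WeierstrassCurve ℚ) [W.IsElliptic] [W.IsGloballyMinimal],
      W.HasSplitMultiplicativeReductionAtPrime 2 → greenberg_stevens (W := W) (p := 2))
    (W : WeierstrassCurve ℚ) [W.IsElliptic] [W.IsGloballyMinimal]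
    (hr : W.analyticRank = 0) (hmult : Mult W 2)
    (W₀ : WeierstrassCurve ℚ) [W₀.IsElliptic] [W₀.IsGloballyMinimal] (hiso : IsIsogenous W W₀)
    [NeZero (W₀.conductorNorm ℤ)] (D : ModularParametrizationData W₀ (W₀.conductorNorm ℤ))
    (hopt : Zhai2021.IsOptimalDatum W₀ D)
    {x y : ℚ} (hP : W₀.toAffine.Equation x y) (h2 : 2 * y + W₀.a₁ * x + W₀.a₃ = 0)
    (hΦ : (TwoTorsionRamifiedAtTwo x ∧ ¬ TwoTorsionOdd W₀ x) ∨
      (TwoTorsionOdd W₀ x ∧ ¬ TwoTorsionRamifiedAtTwo x)) :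
    MissingUpperBoundAt W 2 :=
  missingUpperBoundAt_two_mult_of_roadMember hKato h41ns h41sp hmod hGZK hCassels h514 hC hGS W hr
    hmult W₀ hiso (Or.inr ⟨x, y, hP, h2, hΦ⟩) (Or.inr (Or.inl fun {_} ↦ ⟨D, hopt⟩))

/-! ## §5 The crux decl: «μ = 0 at the optimal curve» classes + the typed residual -/

/-! ### Import refactor H3 (director-bsd 2026-08-26, standing build rule: only an item closer may import a
`…Theses.<Route>` file). The item-closing reductions of this module that CONCLUDE the route declaration
`Theses.ByReductionTypeAtTwo.MultUpperHalfAtTwo` (`multUpperHalfAtTwo_of_optimalMuZero_of_offRoad`) moved VERBATIM to the thin leaf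
`Theorems/ByReductionTypeAtTwoMultUpperHalfCloses.lean`; every other declaration is unchanged, so the
certificate towers importing this file (cone ≈ 1 100 modules, 579 under `Rank1Residual/X5/`) no longer rebuild on
a route edit. -/

end Summit.BirchSwinnertonDyer.BirchSwinnertonDyer.Theorems

end
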